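import Literature.Computability.QuantumComplexity.AaronsonAmbainis
import HarnessLib

/-!
# Counting the oracles consistent with a list of reads (overrides and one flipped bit)

Toolkit file for the polynomial-time half of Aaronson–Ambainis' Thm. 23 (arXiv:0911.0996v3,
p. 14: the means `E[p_ρ]`, variances `Vr[p_ρ]` and influences `Inf_i[p_ρ]` of the restricted
acceptance polynomial of a quantum oracle machine "are computable in `P^{#P}`" — each is a sum,
over tuples of computation paths, of a path weight times the PROBABILITY over the random oracle
that every oracle answer guessed along the paths is the true one). That probability is computed
here, abstractly: an oracle is a point `y ∈ {0,1}^M`; a path reads bits of a VIEW of `y` — `y`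
overridden by the node's restriction list `ρ` (earlier entries outermost, as in
`ClassicalSimulation.nodePoly`/`evalBool_restrictPoly`), possibly after flipping bit `i` (the
second argument of `Inf_i[p] = E[(p(X) − p(X^i))²]`); a READ is `(j, v, fl)`: "bit `j` of the
(flipped if `fl`) view equals `v`".

* `override ρ z`, `firstVal ρ j` (the value the first entry of `ρ` at `j` prescribes),
  `override_apply`; `view ρ i y fl`, `view_apply`;
* `Sat ρ i y R` (all reads of `R` hold at `y`), `forcedVal i r` (the bit of `y` a free read
  forces), `Cons ρ i R` (reads at overridden positions agree with `ρ`, free reads of the same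
  position force the same bit), `freeIdx ρ R` (the distinct free positions read);
* `sat_iff` — `Sat ↔ Cons ∧ y` takes the forced values on `freeIdx`;
* **`card_sat`** — `#{y | Sat ρ i y R} = [Cons ρ i R] · 2^{M − |freeIdx ρ R|}`, and its averaged
  form **`boolAvg_sat`**: `E_y[1_{Sat}] = [Cons] · 2^{−|freeIdx|}` (the factor a counting machine
  attaches to a tuple of paths).

## References

* S. Aaronson, A. Ambainis, *The need for structure in quantum speedups*, Theory Comput. 10
  (2014), proof of Thm. 23 (arXiv:0911.0996v3, p. 14) [AaronsonAmbainis2014].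
* C. H. Bennett, J. Gill, *Relative to a random oracle `A`, `P^A ≠ NP^A ≠ co-NP^A` with
  probability 1*, SIAM J. Comput. 10 (1981), §1 (independence of the bits of a random oracle)
  [BennettGill1981].
-/

noncomputable section

namespace Literature.Computability.QuantumComplexity

namespace OracleReads

open Finset

variable {M : ℕ}

/-! ### Overrides -/

/-- `y` overridden by the restriction list `ρ`, earlier entries outermost (the substitution order
of `ClassicalSimulation.nodePoly`). [folklore] -/
def override (ρ : List (Fin M × Bool)) (z : Fin M → Bool) : Fin M → Bool :=
  ρ.foldr (fun ib z => Function.update z ib.1 ib.2) z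

/-- The value prescribed at `j` by the FIRST entry of `ρ` at `j`, if any. [folklore] -/
def firstVal : List (Fin M × Bool) → Fin M → Option Bool
  | [], _ => none
  | (k, b) :: ρ, j => if k = j then some b else firstVal ρ j

/-- `override [] = id`. [folklore] -/
@[simp] theorem override_nil (z : Fin M → Bool) : override [] z = z := rfl

/-- One more (outermost) entry. [folklore] -/
theorem override_cons (k : Fin M) (b : Bool) (ρ : List (Fin M × Bool)) (z : Fin M → Bool) :
    override ((k, b) :: ρ) z = Function.update (override ρ z) k b := rfl

/-- `firstVal [] = none`. [folklore] -/
@[simp] theorem firstVal_nil (j : Fin M) : firstVal ([] : List (Fin M × Bool)) j = none := rfl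

/-- `firstVal` of a cons. [folklore] -/
theorem firstVal_cons (k : Fin M) (b : Bool) (ρ : List (Fin M × Bool)) (j : Fin M) :
    firstVal ((k, b) :: ρ) j = if k = j then some b else firstVal ρ j := rfl

/-- **The overridden point**: at `j` it is the first prescribed value, else `z j`. [folklore] -/
theorem override_apply : ∀ (ρ : List (Fin M × Bool)) (z : Fin M → Bool) (j : Fin M),
    override ρ z j = (firstVal ρ j).getD (z j)
  | [], z, j => rfl
  | (k, b) :: ρ, z, j => by
    rw [override_cons, firstVal_cons, Function.update_apply]
    by_cases h : j = k
    · subst h; simp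
    · rw [if_neg h, if_neg (Ne.symm h), override_apply ρ z j]

/-- `firstVal ρ j = none` iff no entry of `ρ` is at `j`. [folklore] -/
theorem firstVal_eq_none_iff : ∀ (ρ : List (Fin M × Bool)) (j : Fin M),
    firstVal ρ j = none ↔ ∀ ib ∈ ρ, ib.1 ≠ j
  | [], j => by simp
  | (k, b) :: ρ, j => by
    rw [firstVal_cons]
    by_cases h : k = j
    · simp [h]
    · simp [h, firstVal_eq_none_iff ρ j]

/-! ### Views and reads -/

/-- **The view of the oracle `y` read by a path**: `y`, with bit `i` flipped if `fl`, overridden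
by `ρ`. [cite: AaronsonAmbainis2014, §1 (Inf_i: p(X) versus p(X^i)) and proof of Thm. 23] -/
def view (ρ : List (Fin M × Bool)) (i : Fin M) (y : Fin M → Bool) (fl : Bool) : Fin M → Bool :=
  override ρ (if fl then flipBit i y else y)

/-- The bit of `y` that a free read `(j, v, fl)` forces: `v`, corrected by the flip if `j = i`. [folklore] -/
def forcedVal (i : Fin M) (r : Fin M × Bool × Bool) : Bool :=
  r.2.1 ^^ (r.2.2 && decide (r.1 = i))

/-- **Bits of a view.** [folklore] -/
theorem view_apply (ρ : List (Fin M × Bool)) (i : Fin M) (y : Fin M → Bool) (fl : Bool) (j : Fin M) :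
    view ρ i y fl j = (firstVal ρ j).getD (y j ^^ (fl && decide (j = i))) := by
  unfold view
  rw [override_apply]
  congr 1
  cases fl
  · simp
  · by_cases h : j = i
    · subst h; simp [flipBit]
    · simp [flipBit, h]

/-- **All reads of `R` hold at `y`.** [cite: AaronsonAmbainis2014, proof of Thm. 23] -/
def Sat (ρ : List (Fin M × Bool)) (i : Fin M) (y : Fin M → Bool) (R : List (Fin M × Bool × Bool)) : Prop :=
  ∀ r ∈ R, view ρ i y r.2.2 r.1 = r.2.1

/-- **Consistency of a read list**: reads at overridden positions agree with the override, and
free reads of the same position force the same bit. [folklore] -/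
def Cons (ρ : List (Fin M × Bool)) (i : Fin M) (R : List (Fin M × Bool × Bool)) : Prop :=
  (∀ r ∈ R, ∀ b, firstVal ρ r.1 = some b → r.2.1 = b) ∧
    ∀ r ∈ R, ∀ r' ∈ R, firstVal ρ r.1 = none → r.1 = r'.1 → forcedVal i r = forcedVal i r'

/-- The distinct free positions read. [folklore] -/
def freeIdx (ρ : List (Fin M × Bool)) (R : List (Fin M × Bool × Bool)) : Finset (Fin M) :=
  ((R.filter fun r => firstVal ρ r.1 = none).map fun r => r.1).toFinset

/-- Membership in `freeIdx`. [folklore] -/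
theorem mem_freeIdx {ρ : List (Fin M × Bool)} {R : List (Fin M × Bool × Bool)} {j : Fin M} :
    j ∈ freeIdx ρ R ↔ ∃ r ∈ R, firstVal ρ r.1 = none ∧ r.1 = j := by
  simp [freeIdx, and_assoc]

/-- One read holds iff: at an overridden position its value is the prescribed one, at a free
position `y` takes the forced bit. [folklore] -/
theorem read_iff (ρ : List (Fin M × Bool)) (i : Fin M) (y : Fin M → Bool) (r : Fin M × Bool × Bool) :
    view ρ i y r.2.2 r.1 = r.2.1 ↔
      (∀ b, firstVal ρ r.1 = some b → r.2.1 = b) ∧ (firstVal ρ r.1 = none → y r.1 = forcedVal i r) := by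
  rw [view_apply]
  unfold forcedVal
  cases h : firstVal ρ r.1 with
  | none =>
    simp only [Option.getD_none, reduceCtorEq, IsEmpty.forall_iff, implies_true, true_and, forall_const]
    constructor
    · intro h1; rw [← h1]; cases (r.2.2 && decide (r.1 = i)) <;> simp
    · intro h1; rw [h1]; cases (r.2.2 && decide (r.1 = i)) <;> simp
  | some b =>
    simp only [Option.getD_some, Option.some.injEq, forall_eq', reduceCtorEq, IsEmpty.forall_iff, and_true]
    exact eq_comm

/-- **Satisfaction, resolved**: `Sat ↔ Cons ∧ y` takes the forced bit at every free read. [folklore] -/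
theorem sat_iff (ρ : List (Fin M × Bool)) (i : Fin M) (y : Fin M → Bool) (R : List (Fin M × Bool × Bool)) :
    Sat ρ i y R ↔ Cons ρ i R ∧ ∀ r ∈ R, firstVal ρ r.1 = none → y r.1 = forcedVal i r := by
  unfold Sat Cons
  simp only [read_iff]
  constructor
  · intro h
    refine ⟨⟨fun r hr => (h r hr).1, fun r hr r' hr' hn he => ?_⟩, fun r hr => (h r hr).2⟩
    rw [← (h r hr).2 hn, ← (h r' hr').2 (he ▸ hn), he]
  · rintro ⟨⟨h1, -⟩, h2⟩ r hr
    exact ⟨h1 r hr, h2 r hr⟩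

/-! ### Counting the points with prescribed bits on a set -/

/-- **Cylinder count**: the points of `{0,1}^M` with prescribed bits on `S` number `2^{M − |S|}`. [folklore] -/
theorem card_filter_prescribed (S : Finset (Fin M)) (g : Fin M → Bool) :
    (univ.filter fun y : Fin M → Bool => ∀ j ∈ S, y j = g j).card = 2 ^ (M - S.card) := by
  classical
  let e : {y : Fin M → Bool // ∀ j ∈ S, y j = g j} ≃ ({j : Fin M // j ∉ S} → Bool) :=
    { toFun := fun y j => y.1 j.1
      invFun := fun z => ⟨fun j => if h : j ∈ S then g j else z ⟨j, h⟩, fun j hj => by simp [hj]⟩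
      left_inv := by
        rintro ⟨y, hy⟩
        ext j
        by_cases h : j ∈ S
        · simp [h, hy j h]
        · simp [h]
      right_inv := by
        intro z
        funext ⟨j, hj⟩
        simp [hj] }
  rw [← Fintype.card_subtype, Fintype.card_congr e, Fintype.card_fun, Fintype.card_bool, Fintype.card_subtype_compl,
    Fintype.card_fin, Fintype.card_coe]

/-! ### The count of consistent oracles -/

section Count

variable (ρ : List (Fin M × Bool)) (i : Fin M) (R : List (Fin M × Bool × Bool))

/-- Under `Cons`, the forced bit is a function of the free position. [folklore] -/
theorem exists_forcing (hC : Cons ρ i R) :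
    ∃ g : Fin M → Bool, ∀ r ∈ R, firstVal ρ r.1 = none → forcedVal i r = g r.1 := by
  classical
  refine ⟨fun j => if h : ∃ r ∈ R, firstVal ρ r.1 = none ∧ r.1 = j then forcedVal i (Classical.choose h) else false,
    fun r hr hn => ?_⟩
  have h : ∃ r' ∈ R, firstVal ρ r'.1 = none ∧ r'.1 = r.1 := ⟨r, hr, hn, rfl⟩
  dsimp only
  rw [dif_pos h]
  obtain ⟨hr', hn', he⟩ := Classical.choose_spec h
  exact hC.2 r hr _ hr' hn he.symm

open scoped Classical in
/-- **The number of oracles consistent with the reads**: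
`#{y | Sat ρ i y R} = [Cons ρ i R] · 2^{M − |freeIdx ρ R|}`. [cite: AaronsonAmbainis2014, proof of Thm. 23 (p. 14)] -/
theorem card_sat :
    (univ.filter fun y => Sat ρ i y R).card = if Cons ρ i R then 2 ^ (M - (freeIdx ρ R).card) else 0 := by
  split_ifs with hC
  · obtain ⟨g, hg⟩ := exists_forcing ρ i R hC
    rw [← card_filter_prescribed (freeIdx ρ R) g]
    congr 1
    refine Finset.filter_congr fun y _ => ?_
    rw [sat_iff]
    simp only [hC, true_and, mem_freeIdx]
    constructor
    · rintro h j ⟨r, hr, hn, rfl⟩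
      rw [h r hr hn, hg r hr hn]
    · intro h r hr hn
      rw [hg r hr hn]
      exact h r.1 ⟨r, hr, hn, rfl⟩
  · rw [Finset.card_eq_zero, Finset.filter_eq_empty_iff]
    intro y _ hy
    exact hC ((sat_iff ρ i y R).1 hy).1

/-- The free positions are at most `M`. [folklore] -/
theorem card_freeIdx_le : (freeIdx ρ R).card ≤ M :=
  (card_le_univ _).trans (by simp)

open scoped Classical in
/-- **Averaged form**: `E_y[1_{Sat ρ i y R}] = [Cons ρ i R] · 2^{−|freeIdx ρ R|}` — the weight a
counting machine attaches to a tuple of guessed paths. [cite: AaronsonAmbainis2014, proof of Thm. 23 (p. 14)] -/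
theorem boolAvg_sat :
    boolAvg (fun y => if Sat ρ i y R then (1 : ℝ) else 0) =
      if Cons ρ i R then ((2 : ℝ)⁻¹) ^ (freeIdx ρ R).card else 0 := by
  unfold boolAvg
  rw [Finset.sum_boole, card_sat]
  split_ifs with hC
  · have hle := card_freeIdx_le ρ R
    have hM : (2 : ℝ) ^ M = 2 ^ (M - (freeIdx ρ R).card) * 2 ^ (freeIdx ρ R).card := by
      rw [← pow_add, Nat.sub_add_cancel hle]
    push_cast
    rw [hM, div_mul_cancel_left₀ (pow_ne_zero _ two_ne_zero), inv_pow]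
  · simp

end Count

end OracleReads

end Literature.Computability.QuantumComplexity

end
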